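import Summits.ResolutionOfSingularities.ResolutionOfSingularities.Theorems.EquisingularLiftCampaignW45bULT
import Summits.ResolutionOfSingularities.ResolutionOfSingularities.Theorems.FrobeniusClosingPatchingRelPerfectDepthOneBlowupDimension
import Literature.AlgebraicGeometry.Resolution.Temkin2008Localization
import HarnessLib

/-!
# [OURS · L1 W4.5(b)] Lemma V, persistence half — `EquisingularLift.SpecialFibreReduciblePersistsLN n` HOLDS
# (cell res-hironaka, LADDER-RESOLUTION rung L; slot W4.5(b), crux EL♮ `EquisingularLiftNat`
# stmt-ResolutionOfSingularities-20038; `--supports stmt-ResolutionOfSingularities-20038 --as helper`)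

Everything here is OURS campaign content; nothing is a statement of Hironaka's manuscript and no `Literature.…` named
fact is used. ROUTE-INDEPENDENT module (imports Theorems files and the Resolution library only, never a `Theses/…` file).

## What is proved

* `EquisingularLift.not_isIrreducible_preimage_comp_of_isBlowup` — the topological engine: along a blow-up
  `τ : X″ ⟶ X′` (tree `IsBlowup`, Görtz–Wedhorn I Def. 13.90) of an INTEGRAL, LOCALLY NOETHERIAN scheme `X′`, for all
  morphisms `σ′ : X′ ⟶ P`, `r : P ⟶ S` and every subset `F ⊆ S`: if `(σ′ ≫ r)⁻¹ F` is not irreducible (reducible or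
  empty) then neither is `((τ ≫ σ′) ≫ r)⁻¹ F`. Proof: along the zero ideal the blown-up scheme is empty
  (`IsBlowup.isEmpty_of_bot`, Temkin 2008 Def. 2.2.6); along `C ≠ 0` the blow-up of an integral locally Noetherian
  scheme is SURJECTIVE (`DepthOne.surjective_of_isBlowup`: proper with the generic point in its image), so the
  `X″`-fibre maps onto the `X′`-fibre and a continuous image of an irreducible set is irreducible.
* `EquisingularLift.specialFibreReduciblePersistsLN_holds (n)` — the typed target
  `EquisingularLift.SpecialFibreReduciblePersistsLN n` (res-L1-type-o1, `Theorems/EquisingularLiftCampaignW45bULT.lean`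
  v2 p501162): for a DVR `O`, `X′ X″` over `ℙⁿ_O` with `X′` integral and locally Noetherian, every ideal sheaf `C` and
  every blow-up `τ : X″ ⟶ X′` along `C`, a reducible-or-empty special fibre of `X′` stays reducible-or-empty on `X″`.

## Why the locally-Noetherian sibling and not the as-typed `SpecialFibreReduciblePersists`

The as-typed Prop (p499585) carries no finiteness on `X′` or `C` and is refutable by hand (res-D-pv-002, STATUS
2026-08-27T05:23:58Z; `D/res-D-pv-002/LemmaV-nonNoetherian-witness.md`): for the rank-one non-discrete valuation
ring `V` of `k(t^{1/p^∞})` over `O = k[t]_{(t)}` (`𝔪_V = 𝔪_V²`), `X′ = Spec V[y,z]/(yz − t)` is integral with special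
fibre two lines, and its blow-up along the non-finite-type ideal `(z) + 𝔪_V` is `Proj ⊕ C^d` with special fibre
`𝔸¹_k` — blow-ups of non-Noetherian integral schemes need not be surjective (`Bl_{𝔪_V} Spec V = Spec Frac V`). Every
`X′` the EL♮ / ULT closure produces is a blow-up tower over `ℙⁿ_O`, hence of finite type over `O` and locally
Noetherian, so the sibling is the instance the consumers use. AI-written; no expert review; AI review is weaker than
expert review.

References (context of the OURS words only): U. Görtz, T. Wedhorn, *Algebraic Geometry I*, Def. 13.90 / Prop. 13.92;
M. Temkin, J. Algebra 2008, Def. 2.2.6.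
-/

noncomputable section

set_option linter.dupNamespace false -- mandated namespace of this single-conjunct summit

open CategoryTheory AlgebraicGeometry TopologicalSpace Topology
open Literature.AlgebraicGeometry.Resolution

namespace Summit.ResolutionOfSingularities.ResolutionOfSingularities.Theorems

namespace EquisingularLift

/-- [OURS · L1 W4.5(b)] replaces the role of NOTHING in the manuscript; NOT a statement of the manuscript.
**Topological engine of lemma V (persistence half).** Along a blow-up `τ : X″ ⟶ X′` of an integral locally
Noetherian scheme `X′` (tree `IsBlowup`), for all `σ′ : X′ ⟶ P`, `r : P ⟶ S` and every `F ⊆ S`: if the fibre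
`(σ′ ≫ r)⁻¹ F` is not irreducible (reducible or empty) then `((τ ≫ σ′) ≫ r)⁻¹ F` is not irreducible. Along `C = 0`
the source is empty (`IsBlowup.isEmpty_of_bot`); along `C ≠ 0` the blow-up is surjective
(`DepthOne.surjective_of_isBlowup`), so the `X″`-fibre maps ONTO the `X′`-fibre and irreducibility descends along the
continuous map `τ`. The locally-Noetherian hypothesis is necessary (non-Noetherian blow-ups need not be surjective).
[folklore] -/
theorem not_isIrreducible_preimage_comp_of_isBlowup {X' X'' P S : Scheme.{0}} (σ' : X' ⟶ P) (r : P ⟶ S)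
    {C : X'.IdealSheafData} {τ : X'' ⟶ X'} [IsIntegral X'] [IsLocallyNoetherian X'] (hτ : IsBlowup τ C)
    (F : Set S) (h : ¬ IsIrreducible ((σ' ≫ r : X' ⟶ S) ⁻¹' F)) :
    ¬ IsIrreducible (((τ ≫ σ') ≫ r : X'' ⟶ S) ⁻¹' F) := by
  intro hirr
  by_cases hC : C = ⊥
  · -- blowing up the zero ideal gives the empty scheme, whose fibres are empty, hence not irreducible
    subst hC
    haveI := hτ.isEmpty_of_bot
    exact hirr.nonempty.ne_empty (Set.eq_empty_of_isEmpty _)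
  · -- the blow-up is surjective, so the `X″`-fibre maps onto the `X′`-fibre
    have hsurj := DepthOne.surjective_of_isBlowup hτ hC
    apply h
    have himg : (fun x => τ x) '' (((τ ≫ σ') ≫ r : X'' ⟶ S) ⁻¹' F) = (σ' ≫ r : X' ⟶ S) ⁻¹' F := by
      ext x
      simp only [Set.mem_image, Set.mem_preimage, Scheme.Hom.comp_apply]
      constructor
      · rintro ⟨x', hx', rfl⟩
        exact hx'
      · intro hx
        obtain ⟨x', rfl⟩ := hsurj x
        exact ⟨x', hx, rfl⟩
    rw [← himg]
    exact hirr.image _ τ.base.hom.continuous.continuousOn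

/-- [OURS · L1 W4.5(b)] replaces the role of NOTHING in the manuscript; NOT a statement of the manuscript.
**LEMMA V, PERSISTENCE HALF, HOLDS in its locally-Noetherian form** (`SpecialFibreReduciblePersistsLN`,
res-L1-type-o1 p501162): for every DVR `O`, all `X′ X″` over `ℙⁿ_O` with `X′` integral and locally Noetherian, every
ideal sheaf `C` on `X′` and every blow-up `τ : X″ ⟶ X′` along `C`, if the special fibre of `X′` over the closed point
of `Spec O` is not irreducible then neither is that of `X″`. Immediate from
`not_isIrreducible_preimage_comp_of_isBlowup` at `σ′`, `r = Proj.toSpecZero ≫ Spec.map (algebraMap O _)`,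
`F = {closedPoint O}`. NOT vacuous (singular integral finite-type `X′` with reducible special fibre exist over every
DVR); the as-typed sibling without `IsLocallyNoetherian X′` is refuted by hand (module docstring). [folklore] -/
theorem specialFibreReduciblePersistsLN_holds (n : ℕ) : SpecialFibreReduciblePersistsLN n := by
  intro O _ _ _ X' X'' σ' C τ _ _ hτ h
  exact not_isIrreducible_preimage_comp_of_isBlowup σ' _ hτ _ h

end EquisingularLift

end Summit.ResolutionOfSingularities.ResolutionOfSingularities.Theorems

end
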